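import Literature.NumberTheory.EllipticCurves.SupersingularTorsionValuationProofs
import HarnessLib

/-!
# The valuation of the `2`-torsion at an unramified place of good supersingular reduction above `2`

`Proofs` file (theorems only, no definitions, no named facts), topic `NumberTheory/EllipticCurves`.
The `ℓ = 2` companion of `SupersingularTorsionValuationProofs`: in residue characteristic `2` the
Hasse invariant of `y² + a₁xy + a₃y = x³ + ⋯` is `a₁` (Silverman *AEC* A.1.1(c), Ex. V.5.7), and
the `2`-division polynomial is `Ψ₂² = 4x³ + b₂x² + 2b₄x + b₆`.  At an **absolutely unramified
place of good supersingular reduction above `2`** (`a₁ ∈ 𝔪 = 2R`, `Δ ∈ Rˣ`) its shape is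
`4·x³ + 4(…)x² + 4(…)x + unit` (`b₂ = a₁² + 4a₂`, `2b₄ = 4a₄ + 2a₁a₃` with `a₁ ∈ 2R`;
`b₆ = a₃² + 4a₆` with `a₃ ∈ Rˣ` because `Δ ≡ a₃⁴` modulo `𝔪`, Mathlib `Δ_of_char_two`), so the
two-term domination lemma gives **`|x(P)| > 1` and `|4|·|x(P)|³ = 1` for every point `P` of order
`2`**, i.e. `|2|²·|x|^{2² - 1} = 1` — the same normalisation `|ℓ|²·|x|^{ℓ² - 1} = 1` as for odd `ℓ`
(`WeierstrassCurve.one_lt_valuation_X_of_prime_zsmul_eq_zero_of_supersingular`, uniform in `ℓ`).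
Serre, *Propriétés galoisiennes* (1972), §1.11 (Prop. 12, `e = 1`).

## References

* [Serre1972] J.-P. Serre, Invent. Math. 15 (1972), §1.11, Prop. 12.
* [SilvermanAEC2009] J. H. Silverman, *The Arithmetic of Elliptic Curves*, 2nd ed. (2009),
  III.1, Appendix A Prop. 1.1(c), Exercise 3.7.
-/

noncomputable section

open scoped Classical NNReal
open Polynomial Literature.NumberTheory.EllipticCurves

universe u

namespace WeierstrassCurve

/-! ## Characteristic `2`: `Δ = a₃⁴` when `a₁ = 0` -/

/-- In characteristic `2`, a Weierstrass equation with `a₁ = 0` has `Δ = a₃⁴`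
(Mathlib `Δ_of_char_two`). [cite: SilvermanAEC2009, Appendix A Prop. 1.1(c)] -/
theorem Δ_eq_a₃_pow_four_of_a₁_eq_zero {S : Type*} [CommRing S] [CharP S 2]
    (V : WeierstrassCurve S) (h1 : V.a₁ = 0) : V.Δ = V.a₃ ^ 4 := by
  rw [V.Δ_of_char_two, h1]
  ring

/-! ## The `2`-torsion over a valued field -/

variable {L : Type u} [Field L] {w : Valuation L ℝ≥0}

/-- **`|x(P)| > 1` and `|4|·|x(P)|³ = 1` for the points of order `2`** of a Weierstrass equation
over a valued field with `|b₂| ≤ |4|`, `|2b₄| ≤ |4|`, `|b₆| = 1` and `|4| < 1`: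
`Ψ₂²(x(P)) = 4x³ + b₂x² + 2b₄x + b₆ = 0` (`zsmul_some_eq_zero_iff_eval_ΨSq`, `ΨSq_two`) and
`one_lt_valuation_and_mul_pow_eq_one_of_eval_eq_zero`. [cite: Serre1972, §1.11 Prop. 12] -/
theorem one_lt_valuation_X_of_two_zsmul_eq_zero (V : WeierstrassCurve L)
    (hb2 : w V.b₂ ≤ w (4 : L)) (hb4 : w (2 * V.b₄) ≤ w (4 : L)) (hb6 : w V.b₆ = 1)
    (h4 : w (4 : L) < 1) {x y : L} {h : V.toAffine.Nonsingular x y}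
    (hP : (2 : ℤ) • (Affine.Point.some x y h : V.toAffine.Point) = 0) :
    1 < w x ∧ w (4 : L) * w x ^ 3 = 1 := by
  have hΨ : (V.ΨSq 2).eval x = 0 := (V.zsmul_some_eq_zero_iff_eval_ΨSq h 2).mp hP
  rw [V.ΨSq_two] at hΨ
  set f : L[X] := V.Ψ₂Sq with hf
  have hfdef : f = C 4 * X ^ 3 + C V.b₂ * X ^ 2 + C (2 * V.b₄) * X + C V.b₆ := rfl
  have hdeg : f.natDegree ≤ 3 := by rw [hfdef]; exact natDegree_cubic_le
  have hc0 : f.coeff 0 = V.b₆ := by rw [hfdef]; simp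
  have hc1 : f.coeff 1 = 2 * V.b₄ := by rw [hfdef]; simp
  have hc2 : f.coeff 2 = V.b₂ := by rw [hfdef]; simp
  have hc3 : f.coeff 3 = 4 := by rw [hfdef]; simp
  have key := one_lt_valuation_and_mul_pow_eq_one_of_eval_eq_zero (w := w) (n := 3) hdeg
    (by rw [hc0]; exact hb6) (by rw [hc3]; exact h4) (fun i hi hi3 ↦ by
      interval_cases i
      · rw [hc1, hc3]; exact hb4
      · rw [hc2, hc3]; exact hb2) hΨ
  rwa [hc3] at key

/-- **The same at an absolutely unramified place of good supersingular reduction above `2`.**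
Let `R → L` be a local ring mapping into the valuation ring of `(L, w)`, with residue field of
characteristic `2`, `𝔪_R ⊆ 2R` (`e = 1`), `w 2 < 1`; let `M/R` be a Weierstrass equation with
`Δ(M) ∈ Rˣ` and `a₁(M) ∈ 𝔪_R` (good supersingular reduction in characteristic `2`).  Then
every affine point `P = (x, y)` of `M_L` with `2 • P = O` has `|x| > 1` and `|4|·|x|³ = 1`.
[cite: Serre1972, §1.11 Prop. 12] [cite: SilvermanAEC2009, Appendix A Prop. 1.1(c)] -/
theorem one_lt_valuation_X_of_two_zsmul_eq_zero_of_a₁_mem {R : Type*} [CommRing R]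
    [IsLocalRing R] [CharP (IsLocalRing.ResidueField R) 2] (φ : R →+* L)
    (hR : ∀ c : R, w (φ c) ≤ 1)
    (hgen : ∀ c ∈ IsLocalRing.maximalIdeal R, (2 : R) ∣ c) (h2w : w (2 : L) < 1)
    (M : WeierstrassCurve R) (hΔ : IsUnit M.Δ) (hA : M.a₁ ∈ IsLocalRing.maximalIdeal R)
    {x y : L} {h : (M.map φ).toAffine.Nonsingular x y}
    (hP : (2 : ℤ) • (Affine.Point.some x y h : (M.map φ).toAffine.Point) = 0) :
    1 < w x ∧ w (4 : L) * w x ^ 3 = 1 := by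
  set res := IsLocalRing.residue R with hres
  have h2k : (2 : IsLocalRing.ResidueField R) = 0 := by
    simpa using CharP.cast_eq_zero (IsLocalRing.ResidueField R) 2
  have h4k : (4 : IsLocalRing.ResidueField R) = 0 := by
    rw [show (4 : IsLocalRing.ResidueField R) = 2 * 2 by norm_num, h2k, zero_mul]
  -- `a₃` is a unit: `Δ ≡ a₃⁴ (mod 𝔪)`
  have ha3 : IsUnit M.a₃ := by
    rw [← IsLocalRing.residue_ne_zero_iff_isUnit]
    intro h0
    have h1 : (M.map res).a₁ = 0 := by
      rw [map_a₁, hres, IsLocalRing.residue_eq_zero_iff]; exact hA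
    have hΔ' : (M.map res).Δ = 0 := by
      rw [Δ_eq_a₃_pow_four_of_a₁_eq_zero _ h1, map_a₃]
      change res M.a₃ ^ 4 = 0
      rw [h0, zero_pow four_ne_zero]
    rw [map_Δ] at hΔ'
    exact (IsLocalRing.residue_ne_zero_iff_isUnit _).mpr hΔ hΔ'
  -- valuations of units
  have hunit : ∀ u : R, IsUnit u → w (φ u) = 1 := by
    intro u hu
    obtain ⟨u, rfl⟩ := hu
    refine le_antisymm (hR _) ?_
    have h1 : w (φ (u : R)) * w (φ (↑u⁻¹ : R)) = 1 := by
      rw [← map_mul, ← map_mul, Units.mul_inv, map_one, map_one]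
    calc (1 : ℝ≥0) = w (φ (u : R)) * w (φ (↑u⁻¹ : R)) := h1.symm
      _ ≤ w (φ (u : R)) * 1 := mul_le_mul_right (hR _) _
      _ = w (φ (u : R)) := mul_one _
  have h4 : w (4 : L) = w (2 : L) ^ 2 := by rw [← map_pow]; norm_num
  obtain ⟨c, hc⟩ := hgen _ hA
  -- the hypotheses of the valued-field lemma for `M_L`
  have hb2 : w (M.map φ).b₂ ≤ w (4 : L) := by
    rw [map_b₂, b₂, hc, show (2 * c) ^ 2 + 4 * M.a₂ = 4 * (c ^ 2 + M.a₂) by ring, map_mul,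
      map_ofNat, map_mul]
    calc w (4 : L) * w (φ (c ^ 2 + M.a₂)) ≤ w 4 * 1 := mul_le_mul_right (hR _) _
      _ = w 4 := mul_one _
  have hb4 : w (2 * (M.map φ).b₄) ≤ w (4 : L) := by
    rw [map_b₄, b₄, hc, ← map_ofNat φ 2, ← map_mul,
      show (2 : R) * (2 * M.a₄ + 2 * c * M.a₃) = 4 * (M.a₄ + c * M.a₃) by ring, map_mul,
      map_ofNat, map_mul]
    calc w (4 : L) * w (φ (M.a₄ + c * M.a₃)) ≤ w 4 * 1 := mul_le_mul_right (hR _) _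
      _ = w 4 := mul_one _
  have hb6 : w (M.map φ).b₆ = 1 := by
    rw [map_b₆]
    apply hunit
    -- `b₆ = a₃² + 4 a₆` with `a₃` a unit and `4 = 0` in the residue field
    rw [← IsLocalRing.residue_ne_zero_iff_isUnit, b₆, map_add, map_pow, map_mul, map_ofNat, h4k,
      zero_mul, add_zero]
    exact pow_ne_zero 2 ((IsLocalRing.residue_ne_zero_iff_isUnit _).mpr ha3)
  have h4w : w (4 : L) < 1 := by
    rw [h4]
    exact pow_lt_one₀ zero_le h2w two_ne_zero
  exact one_lt_valuation_X_of_two_zsmul_eq_zero (M.map φ) hb2 hb4 hb6 h4w hP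

/-! ## Uniform statement for every prime `ℓ` -/

/-- **`|x(P)| > 1` and `|ℓ|²·|x(P)|^{ℓ² - 1} = 1` for the `ℓ`-torsion at an absolutely unramified
place of good supersingular reduction, for every prime `ℓ`** (odd `ℓ`: the square of
`one_lt_valuation_X_of_prime_zsmul_eq_zero_of_hasseCoeff_mem`; `ℓ = 2`:
`one_lt_valuation_X_of_two_zsmul_eq_zero_of_a₁_mem`).  The supersingularity hypothesis is
`a₁(M) ∈ 𝔪_R` for `ℓ = 2` and `A_ℓ(M) ∈ 𝔪_R` for odd `ℓ`.
[cite: Serre1972, §1.11 Prop. 12] -/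
theorem one_lt_valuation_X_of_prime_zsmul_eq_zero_of_supersingular {R : Type*} [CommRing R]
    [IsLocalRing R] [Finite (IsLocalRing.ResidueField R)] {ℓ : ℕ}
    [hℓ : Fact ℓ.Prime] [CharP (IsLocalRing.ResidueField R) ℓ] (φ : R →+* L)
    (hR : ∀ c : R, w (φ c) ≤ 1)
    (hgen : ∀ c ∈ IsLocalRing.maximalIdeal R, (ℓ : R) ∣ c) (hℓw : w ℓ < 1) (hℓL : (ℓ : L) ≠ 0)
    (M : WeierstrassCurve R) (hΔ : IsUnit M.Δ)
    (hA : (if ℓ = 2 then M.a₁ else M.hasseCoeff ℓ) ∈ IsLocalRing.maximalIdeal R)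
    {x y : L} {h : (M.map φ).toAffine.Nonsingular x y}
    (hP : (ℓ : ℤ) • (Affine.Point.some x y h : (M.map φ).toAffine.Point) = 0) :
    1 < w x ∧ w ℓ ^ 2 * w x ^ (ℓ ^ 2 - 1) = 1 := by
  by_cases hℓ2 : ℓ = 2
  · subst hℓ2
    rw [if_pos rfl] at hA
    have h2w : w (2 : L) < 1 := by exact_mod_cast hℓw
    have hP' : (2 : ℤ) • (Affine.Point.some x y h : (M.map φ).toAffine.Point) = 0 := by
      exact_mod_cast hP
    obtain ⟨h1, h2⟩ := one_lt_valuation_X_of_two_zsmul_eq_zero_of_a₁_mem φ hR hgen h2w M hΔ hA hP'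
    refine ⟨h1, ?_⟩
    rw [show (2 : ℕ) ^ 2 - 1 = 3 by norm_num, Nat.cast_ofNat, ← map_pow]
    norm_num
    exact h2
  · rw [if_neg hℓ2] at hA
    letI : Algebra R L := φ.toAlgebra
    obtain ⟨h1, h2⟩ := one_lt_valuation_X_of_prime_zsmul_eq_zero_of_hasseCoeff_mem hℓ2 hR hgen hℓw
      hℓL M hΔ hA hP
    refine ⟨h1, ?_⟩
    -- `ℓ² - 1 = 2 ((ℓ² - 1) / 2)` for odd `ℓ`
    obtain ⟨t, ht⟩ : Even (ℓ ^ 2 - 1) := Nat.Odd.sub_odd ((hℓ.out.odd_of_ne_two hℓ2).pow) odd_one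
    have he : ℓ ^ 2 - 1 = 2 * ((ℓ ^ 2 - 1) / 2) := by omega
    rw [he, pow_mul']
    calc w (ℓ : L) ^ 2 * (w x ^ ((ℓ ^ 2 - 1) / 2)) ^ 2
        = (w (ℓ : L) * w x ^ ((ℓ ^ 2 - 1) / 2)) ^ 2 := by ring
      _ = 1 := by rw [h2, one_pow]

end WeierstrassCurve

end
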